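import Literature.Computability.AlgebraicComplexity.BorderRankMatMulThreeVerdict
import Literature.Computability.AlgebraicComplexity.BorderRankMatMulThreeEnumData
import HarnessLib

/-!
# Borel-fixed `(110)`-candidates of `⟨3,3,3⟩`, XII: completeness of the profile tables

Topic `Literature/Computability/AlgebraicComplexity`. The profile `(rootSet E, δOf E)` of an
admissible `E ≤ A ⊗ B` (`BorderRankMatMulThreeBlocks.lean`) has Borel-stable blocks
(`MatMul3.IsAdmissible.blockOK`), is monotone along rows and columns and has budget `≤ 7`
(`BorderRankMatMulThreeProfile.lean`). Here the kernel enumerates ALL such profiles by a verified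
depth-first search and finds exactly the `280 = 272 + 8` profiles of the tables of
`BorderRankMatMulThreeEnumData.lean`:

* `MatMul3.exts`, `MatMul3.mem_exts` — a generic pruned enumeration of lists and its completeness;
* `MatMul3.bt15_complete` — every Borel-stable block code is one of the `15` types (kernel);
* `MatMul3.allProfs_covered` — every enumerated profile is killed or a survivor (kernel);
* `MatMul3.IsAdmissible.encodeProf_mem` — **the profile of an admissible `E` is in the tables**;
* `MatMul3.IsAdmissible.mem_survivors8` — **if moreover `E` passes both tests
  (`dim testI E ≥ 16`, `dim testK E ≥ 16`) and the kernel verdicts of the killed table hold, the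
  profile of `E` is one of CHL's eight survivors.**

## References

* A. Conner, A. Harper, J. M. Landsberg, *New lower bounds for matrix multiplication and `det₃`*,
  Forum Math. Pi 11 (2023) e17, arXiv:1911.07981 — §6. [ConnerHarperLandsberg2023]
-/

open scoped BigOperators

namespace Literature.Computability.AlgebraicComplexity

namespace BorderApolarity

namespace MatMul3

universe u

/-! ## A verified pruned enumeration -/

/-- All extensions of the prefix `p` by `n` further candidates, each accepted by `ok` given the
prefix before it. [folklore] -/
def exts {α : Type*} (ok : List α → α → Bool) (cands : List α) : ℕ → List α → List (List α)
  | 0, p => [p]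
  | n + 1, p => (cands.filter (ok p)).flatMap fun a => exts ok cands n (p ++ [a])

/-- **Completeness of the enumeration**: a continuation by candidates accepted step by step is
enumerated. [folklore] -/
theorem mem_exts {α : Type*} (ok : List α → α → Bool) (cands : List α) :
    ∀ (s p : List α), (∀ a ∈ s, a ∈ cands) →
      (∀ (i : ℕ) (h : i < s.length), ok (p ++ s.take i) s[i] = true) →
      p ++ s ∈ exts ok cands s.length p
  | [], p, _, _ => by simp [exts]
  | a :: s, p, hc, hok => by
      rw [List.length_cons, exts, List.mem_flatMap]
      have h0 := hok 0 (by simp)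
      simp only [List.take_zero, List.append_nil, List.getElem_cons_zero] at h0
      refine ⟨a, List.mem_filter.2 ⟨hc a (by simp), h0⟩, ?_⟩
      rw [show p ++ a :: s = (p ++ [a]) ++ s by simp]
      refine mem_exts ok cands s (p ++ [a]) (fun b hb => hc b (by simp [hb])) fun i hi => ?_
      have := hok (i + 1) (by simpa using hi)
      simpa [List.take_succ_cons, List.append_assoc] using this

/-! ## The enumeration of admissible profiles -/

/-- Containment of block codes: roots `⊆` and `δ ≤`. [folklore] -/
def codeSub (a b : List (ℕ × ℕ) × ℕ) : Bool :=
  (a.1.all fun x => b.1.contains x) && decide (a.2 ≤ b.2)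

/-- The step test of the enumeration at position `n = 3j + k` (the length of the prefix): the new
block is contained in the block above (`n - 3`) and in the block to the left (`n - 1`, if `k ≠ 0`),
and the budget so far is `≤ 7`. [cite: ConnerHarperLandsberg2023, §6] -/
def okStep (p : List (List (ℕ × ℕ) × ℕ)) (a : List (ℕ × ℕ) × ℕ) : Bool :=
  (decide (p.length < 3) || codeSub a (p.getD (p.length - 3) ([], 0))) &&
  (decide (p.length % 3 = 0) || codeSub a (p.getD (p.length - 1) ([], 0))) &&
  decide (((p ++ [a]).map fun b => b.1.length + b.2).sum ≤ 7)

/-- All weakly admissible profiles: blocks of the `15` types, monotone, budget `≤ 7`.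
[cite: ConnerHarperLandsberg2023, §6] -/
def allProfs : List (List (List (ℕ × ℕ) × ℕ)) := exts okStep bt15 9 []

/-- **Kernel check: every weakly admissible profile is in the tables** (killed or survivor).
[cite: ConnerHarperLandsberg2023, §6] -/
theorem allProfs_covered :
    (allProfs.all fun q => (killedProfs.map Prod.fst).contains q || survivors8.contains q) = true := by
  decide +kernel

/-- **Kernel check: the `15` block types are all the Borel-stable block codes.**
[cite: ConnerHarperLandsberg2023, §6] -/
theorem bt15_complete :
    ∀ R : Finset (Fin 3 × Fin 3), ∀ δ : Fin 3, BlockOK R δ → (encodeR R, (δ : ℕ)) ∈ bt15 := by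
  decide +kernel

/-- Containment of blocks gives containment of codes. [folklore] -/
theorem codeSub_encodeR {R R' : Finset (Fin 3 × Fin 3)} {δ δ' : ℕ} (hR : R ⊆ R') (hδ : δ ≤ δ') :
    codeSub (encodeR R, δ) (encodeR R', δ') = true := by
  simp only [codeSub, Bool.and_eq_true, List.all_eq_true, decide_eq_true_eq]
  refine ⟨fun x hx => ?_, hδ⟩
  rw [encodeR, List.mem_map] at hx
  obtain ⟨p, hp, rfl⟩ := hx
  rw [List.mem_filter, decide_eq_true_eq] at hp
  rw [List.contains_iff_mem]
  exact mem_encodeR.2 (hR hp.2)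

/-- `((List.range 9).map f).sum = ∑_{jk} f (jkCode jk)`. [folklore] -/
theorem sum_map_range_nine (f : ℕ → ℕ) :
    ((List.range 9).map f).sum = ∑ jk : Fin 3 × Fin 3, f (jkCode jk) := by
  simp only [Fintype.sum_prod_type, Fin.sum_univ_three, jkCode, Fin.val_zero, Fin.val_one,
    Fin.val_two]
  simp [List.range_succ]
  ring

/-- **Completeness for profiles**: a profile with Borel-stable-typed blocks, monotone along rows and
columns, of budget `≤ 7`, is enumerated. [cite: ConnerHarperLandsberg2023, §6] -/
theorem encodeProf_mem_allProfs (Rf : Fin 3 × Fin 3 → Finset (Fin 3 × Fin 3)) (δf : Fin 3 × Fin 3 → ℕ)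
    (hbt : ∀ jk, (encodeR (Rf jk), δf jk) ∈ bt15)
    (hrow : ∀ p q : Fin 3, p < q → ∀ k, Rf (q, k) ⊆ Rf (p, k) ∧ δf (q, k) ≤ δf (p, k))
    (hcol : ∀ p q : Fin 3, p < q → ∀ j, Rf (j, q) ⊆ Rf (j, p) ∧ δf (j, q) ≤ δf (j, p))
    (hbud : ∑ jk : Fin 3 × Fin 3, ((Rf jk).card + δf jk) ≤ 7) :
    encodeProf Rf δf ∈ allProfs := by
  unfold encodeProf allProfs
  set g : ℕ → List (ℕ × ℕ) × ℕ := fun n => (encodeR (Rf (jkDecode n)), δf (jkDecode n)) with hg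
  set s := (List.range 9).map g with hs
  have hlen : s.length = 9 := by simp [hs]
  have hget : ∀ n (h : n < s.length), s[n] = g n := by
    intro n h; simp [hs]
  have hgetD : ∀ n < 9, s.getD n ([], 0) = g n := by
    intro n hn
    rw [List.getD_eq_getElem?_getD, List.getElem?_eq_getElem (by omega), Option.getD_some, hget]
  -- containments above / to the left, by cases on the position
  have hup : ∀ n, 3 ≤ n → n < 9 → codeSub (g n) (g (n - 3)) = true := by
    intro n h3 h9
    interval_cases n
    all_goals exact codeSub_encodeR (hrow _ _ (by decide) _).1 (hrow _ _ (by decide) _).2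
  have hleft : ∀ n, n % 3 ≠ 0 → n < 9 → codeSub (g n) (g (n - 1)) = true := by
    intro n h3 h9
    interval_cases n <;> first | exact absurd rfl h3 |
      exact codeSub_encodeR (hcol _ _ (by decide) _).1 (hcol _ _ (by decide) _).2
  -- the budget of every prefix
  have htot : (s.map fun b => b.1.length + b.2).sum ≤ 7 := by
    rw [hs, List.map_map, sum_map_range_nine]
    refine le_of_eq_of_le (Finset.sum_congr rfl fun jk _ => ?_) hbud
    simp [hg, jkDecode_jkCode, length_encodeR]
  have key := mem_exts okStep bt15 s [] (fun a ha => ?_) (fun i hi => ?_)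
  · simpa [hlen] using key
  · rw [hs, List.mem_map] at ha
    obtain ⟨n, -, rfl⟩ := ha
    exact hbt _
  · rw [hlen] at hi
    rw [List.nil_append, hget, okStep]
    simp only [List.length_take, hlen, Bool.and_eq_true, Bool.or_eq_true,
      decide_eq_true_eq]
    refine ⟨⟨?_, ?_⟩, ?_⟩
    · by_cases h3 : i < 3
      · exact Or.inl (by omega)
      · right
        rw [show min i 9 = i by omega, List.getD_eq_getElem?_getD, List.getElem?_take,
          if_pos (by omega), ← List.getD_eq_getElem?_getD, hgetD _ (by omega)]
        exact hup i (by omega) hi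
    · by_cases h3 : i % 3 = 0
      · exact Or.inl (by omega)
      · right
        rw [show min i 9 = i by omega, List.getD_eq_getElem?_getD, List.getElem?_take,
          if_pos (by omega), ← List.getD_eq_getElem?_getD, hgetD _ (by omega)]
        exact hleft i h3 hi
    · rw [← hget i (by omega), ← List.take_succ_eq_append_getElem]
      exact le_trans (List.Sublist.sum_le_sum ((List.take_sublist (i + 1) s).map _)
        fun _ _ => Nat.zero_le _) htot

/-! ## The profile of an admissible subspace -/

variable {K : Type u} [Field K] [CharZero K] {E : Submodule K (I9' × I9' → K)}

/-- **The profile of an admissible `E` is one of the `280` tabulated profiles.**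
[cite: ConnerHarperLandsberg2023, §6] -/
theorem IsAdmissible.encodeProf_mem (hE : IsAdmissible E) :
    encodeProf (fun jk => rootSet E jk.1 jk.2) (δOf E) ∈ allProfs := by
  refine encodeProf_mem_allProfs _ _ (fun jk => ?_) (fun p q hpq k => ?_) (fun p q hpq j => ?_)
    hE.budget
  · have hb := hE.blockOK jk
    have h2 : δOf E jk < 3 := by have := hb.2.2.2.2.2.2.2; omega
    exact bt15_complete _ ⟨δOf E jk, h2⟩ hb
  · exact ⟨hE.rootSet_mono_row hpq k, hE.δOf_mono_row hpq k⟩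
  · exact ⟨hE.rootSet_mono_col hpq j, hE.δOf_mono_col hpq j⟩

/-- **Survivors**: an admissible `E` passing both tests, given the kernel verdicts of the killed
table, has one of the eight surviving profiles. [cite: ConnerHarperLandsberg2023, §6] -/
theorem IsAdmissible.mem_survivors8 (hE : IsAdmissible E)
    (hrun : ∀ ph ∈ killedProfs, Ker.verdictH ph.1 ph.2 = true)
    (hI : 16 ≤ Module.finrank K (testI E)) (hK : 16 ≤ Module.finrank K (testK E)) :
    encodeProf (fun jk => rootSet E jk.1 jk.2) (δOf E) ∈ survivors8 := by
  have hmem := hE.encodeProf_mem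
  have hall := List.all_eq_true.1 allProfs_covered _ hmem
  rw [Bool.or_eq_true, List.contains_iff_mem, List.contains_iff_mem, List.mem_map] at hall
  rcases hall with ⟨ph, hph, heq⟩ | h
  · have hv := hrun ph hph
    rw [heq] at hv
    rcases hE.test_le_of_verdictH ph.2 hv with h | h <;> omega
  · exact h

end MatMul3

end BorderApolarity

end Literature.Computability.AlgebraicComplexity
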